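import Summits.CriticalPhenomena.PercolationContinuityZ3.Theorems.SoloBlindKNUniformCoefficients

/-!
# Covering constraints hidden in Kozma–Nitzan's Conjecture 4, and the `|A| = 2` rigidity

Companion to `SoloBlindKNUniformCoefficients.lean` / `SoloBlindKNLayerCake.lean` (Conjecture 4 of [KozmaNitzan2024]
at `(G, A, o)` ⟺ `KNUniformUpsets w A o`: one probability vector `c` on `A` with
`∑_a c_a μ(C(a) ∈ 𝒰, o ↔ A) ≤ μ(C(o) ∈ 𝒰, o ↔ A)` for every up-set `𝒰` of vertex sets).

Taking for `𝒰` the event "the cluster meets `A ∖ D`" (`D ⊆ A`) and using `∑ c_a = 1` turns the UPPER bounds of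
Question 5 into LOWER bounds on partial sums of `c` (`covering_of_uniform`):

  `μ(o ↔ A, C(o) ∩ (A∖D) = ∅) ≤ ∑_{a ∈ D} c_a · μ(o ↔ A, C(a) ∩ (A∖D) = ∅)`.

For `A = {a₁, a₂}` these two lower bounds already add up to `∑ c = 1`, so the uniform vector is UNIQUE and explicit
(`pair_rigidity`): `c_{a₁} · (x₁ + x₂) = x₁`, `c_{a₂} · (x₁ + x₂) = x₂` with `x_i = μ(o ↔ a_i, o ↮ a_j)` the single-contact
probabilities.  Combined with Theorem 7 of [KozmaNitzan2024] (Conjecture 4 holds for `|A| = 2`; not formalised here) this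
says: the `b`-independent coefficients of their §5.2 are, for two targets, exactly the normalised law of the single contact of
`C(o)` with `A`.  New; finite graphs, arbitrary weights; no sorry, no new axioms.
[cite: KozmaNitzan2024, Conjecture 4 and Theorem 7 (p. 32), Question 5 (pp. 32–33)]
-/

noncomputable section

open MeasureTheory Set Finset
open scoped BigOperators
open Literature.Probability.LatticeModels (prodBernoulli)
open Literature.Probability.Percolation

namespace Summit.CriticalPhenomena.PercolationContinuityZ3.Theorems.SoloBlindKN

section Percolation

variable {V : Type*} [Fintype V] [DecidableEq V]

/-- The family of vertex sets meeting `B`; an up-set.  `{C(x) ∈ meets B} = {x ↔ B}`. -/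
def meets (B : Finset V) : Set (Set V) := {S | ∃ y ∈ B, y ∈ S}

omit [Fintype V] [DecidableEq V] in
/-- `meets B` is an up-set. -/
theorem isUpperSet_meets (B : Finset V) : IsUpperSet (meets B) := by
  rintro S T hST ⟨y, hyB, hyS⟩
  exact ⟨y, hyB, hST hyS⟩

omit [DecidableEq V] in
/-- `μ(C(x) meets B, o ↔ A) + μ(o ↔ A, C(x) ∩ B = ∅) = μ(o ↔ A)`. -/
theorem real_meets_add_misses (w : Sym2 V → unitInterval) (A B : Finset V) (o x : V) :
    (prodBernoulli w).real ({ω | openCluster ω x ∈ meets B} ∩ connTo o A) +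
      (prodBernoulli w).real (connTo o A ∩ {ω | ∀ y ∈ B, y ∉ openCluster ω x}) =
      (prodBernoulli w).real (connTo o A) := by
  have h := measureReal_inter_add_sdiff (μ := prodBernoulli w) (s := connTo o A)
    (MeasurableSet.of_discrete : MeasurableSet {ω : BondConfig V | openCluster ω x ∈ meets B})
  have e1 : {ω : BondConfig V | openCluster ω x ∈ meets B} ∩ connTo o A =
      connTo o A ∩ {ω | openCluster ω x ∈ meets B} := inter_comm _ _
  have e2 : connTo o A ∩ {ω : BondConfig V | ∀ y ∈ B, y ∉ openCluster ω x} =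
      connTo o A \ {ω | openCluster ω x ∈ meets B} := by
    ext ω
    simp only [meets, mem_inter_iff, mem_setOf_eq, mem_sdiff, not_exists, not_and]
  rw [e1, e2]
  exact h

omit [Fintype V] [DecidableEq V] in
/-- For `a ∈ B` the cluster of `a` always meets `B`. -/
theorem real_meets_of_mem (w : Sym2 V → unitInterval) (A B : Finset V) (o a : V) (ha : a ∈ B) :
    (prodBernoulli w).real ({ω | openCluster ω a ∈ meets B} ∩ connTo o A) =
      (prodBernoulli w).real (connTo o A) := by
  congr 1
  ext ω
  simp only [meets, mem_inter_iff, mem_setOf_eq, and_iff_right_iff_imp]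
  exact fun _ => ⟨a, ha, mem_openCluster_self ω a⟩

/-- **Covering constraints.**  If `c` (with `∑_{a∈A} c_a = 1`) dominates every up-set as in `KNUniformUpsets`, then
for every `D ⊆ A`:  `μ(o ↔ A, C(o) ∩ (A∖D) = ∅) ≤ ∑_{a∈D} c_a μ(o ↔ A, C(a) ∩ (A∖D) = ∅)`.  (New.) -/
theorem covering_of_uniform (w : Sym2 V → unitInterval) (A : Finset V) (o : V) (c : V → ℝ)
    (hc1 : ∑ a ∈ A, c a = 1)
    (hc : ∀ 𝒰 : Set (Set V), IsUpperSet 𝒰 →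
      ∑ a ∈ A, c a * clusterExp w A o (setInd 𝒰) a ≤ clusterExp w A o (setInd 𝒰) o)
    (D : Finset V) (hD : D ⊆ A) :
    (prodBernoulli w).real (connTo o A ∩ {ω | ∀ y ∈ A \ D, y ∉ openCluster ω o}) ≤
      ∑ a ∈ D, c a * (prodBernoulli w).real (connTo o A ∩ {ω | ∀ y ∈ A \ D, y ∉ openCluster ω a}) := by
  classical
  have key := hc (meets (A \ D)) (isUpperSet_meets (A \ D))
  simp only [clusterExp_setInd] at key
  -- abbreviations as plain equalities (no `set`, to keep `linarith` atoms aligned)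
  have e : ∀ x, (prodBernoulli w).real ({ω | openCluster ω x ∈ meets (A \ D)} ∩ connTo o A) =
      (prodBernoulli w).real (connTo o A) -
        (prodBernoulli w).real (connTo o A ∩ {ω | ∀ y ∈ A \ D, y ∉ openCluster ω x}) := by
    intro x
    have := real_meets_add_misses w A (A \ D) o x
    linarith
  have eB : ∀ a ∈ A \ D,
      (prodBernoulli w).real (connTo o A ∩ {ω | ∀ y ∈ A \ D, y ∉ openCluster ω a}) = 0 := by
    intro a ha
    have h1 := real_meets_add_misses w A (A \ D) o a
    rw [real_meets_of_mem w A (A \ D) o a ha] at h1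
    linarith
  have hsum := (Finset.sum_sdiff hD (f := fun a => c a *
    (prodBernoulli w).real ({ω | openCluster ω a ∈ meets (A \ D)} ∩ connTo o A)))
  have hc1' := hc1
  rw [← Finset.sum_sdiff hD] at hc1'
  have h1 : ∑ a ∈ A \ D, c a * (prodBernoulli w).real ({ω | openCluster ω a ∈ meets (A \ D)} ∩ connTo o A) =
      (∑ a ∈ A \ D, c a) * (prodBernoulli w).real (connTo o A) := by
    rw [Finset.sum_mul]
    refine Finset.sum_congr rfl fun a ha => ?_
    rw [e a, eB a ha, sub_zero]
  have h2 : ∑ a ∈ D, c a * (prodBernoulli w).real ({ω | openCluster ω a ∈ meets (A \ D)} ∩ connTo o A) =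
      (∑ a ∈ D, c a) * (prodBernoulli w).real (connTo o A) -
        ∑ a ∈ D, c a * (prodBernoulli w).real (connTo o A ∩ {ω | ∀ y ∈ A \ D, y ∉ openCluster ω a}) := by
    rw [Finset.sum_mul, ← Finset.sum_sub_distrib]
    refine Finset.sum_congr rfl fun a _ => ?_
    rw [e a]; ring
  rw [← hsum, h1, h2, e o] at key
  have h3 : (∑ a ∈ A \ D, c a) * (prodBernoulli w).real (connTo o A) +
      (∑ a ∈ D, c a) * (prodBernoulli w).real (connTo o A) = (prodBernoulli w).real (connTo o A) := by
    rw [← add_mul, hc1', one_mul]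
  linarith

/-- The covering constraints follow from `KNUniformUpsets` (hence from Conjecture 4 at `(G, A, o)`). -/
theorem covering_of_uniformUpsets (w : Sym2 V → unitInterval) (A : Finset V) (o : V)
    (h : KNUniformUpsets w A o) :
    ∃ c : V → ℝ, (∀ a, 0 ≤ c a) ∧ ∑ a ∈ A, c a = 1 ∧
      (∀ b : V, ∑ a ∈ A, c a * (prodBernoulli w).real (openConn a b ∩ connTo o A) ≤
        (prodBernoulli w).real (openConn o b ∩ connTo o A)) ∧
      ∀ D ⊆ A, (prodBernoulli w).real (connTo o A ∩ {ω | ∀ y ∈ A \ D, y ∉ openCluster ω o}) ≤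
        ∑ a ∈ D, c a * (prodBernoulli w).real (connTo o A ∩ {ω | ∀ y ∈ A \ D, y ∉ openCluster ω a}) := by
  obtain ⟨c, hc0, hc1, hc⟩ := h
  -- use the SAME vector `c` for both families (re-derive the connection rows for `c`)
  refine ⟨c, hc0, hc1, fun b => ?_, fun D hD => covering_of_uniform w A o c hc1 hc D hD⟩
  have key := hc {S : Set V | b ∈ S} (isUpperSet_containing b)
  simp only [clusterExp_setInd, setOf_mem_openCluster] at key
  exact key

/-! ### Two targets: the uniform vector is unique -/

omit [Fintype V] in
/-- On `{o ↔ {a₁,a₂}}` (`a₁ ≠ a₂`): `C(o)` misses `a₂` iff `o ↔ a₁` and `o ↮ a₂`. -/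
theorem connTo_pair_misses_eq (o a₁ a₂ : V) (h12 : a₁ ≠ a₂) :
    connTo o ({a₁, a₂} : Finset V) ∩ {ω | ∀ y ∈ ({a₁, a₂} : Finset V) \ {a₁}, y ∉ openCluster ω o} =
      openConn o a₁ ∩ (openConn o a₂)ᶜ := by
  have hsd : ({a₁, a₂} : Finset V) \ {a₁} = {a₂} := by
    ext y
    simp only [Finset.mem_sdiff, Finset.mem_insert, Finset.mem_singleton]
    constructor
    · rintro ⟨h | h, hne⟩
      · exact absurd h hne
      · exact h
    · rintro rfl; exact ⟨Or.inr rfl, fun h => h12 h.symm⟩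
  rw [hsd]
  ext ω
  simp only [connTo, mem_inter_iff, mem_iUnion, Finset.mem_insert, Finset.mem_singleton, exists_prop,
    mem_setOf_eq, mem_compl_iff, forall_eq]
  constructor
  · rintro ⟨⟨a, ha, hω⟩, hmiss⟩
    rcases ha with rfl | rfl
    · exact ⟨hω, hmiss⟩
    · exact absurd hω hmiss
  · rintro ⟨h1, h2⟩
    exact ⟨⟨a₁, Or.inl rfl, h1⟩, h2⟩

omit [Fintype V] in
/-- On `{o ↔ {a₁,a₂}}` (`a₁ ≠ a₂`): `C(a₁)` misses `a₂` iff exactly one of `a₁, a₂` is joined to `o`. -/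
theorem connTo_pair_notConn_eq (o a₁ a₂ : V) (h12 : a₁ ≠ a₂) :
    connTo o ({a₁, a₂} : Finset V) ∩ {ω | ∀ y ∈ ({a₁, a₂} : Finset V) \ {a₁}, y ∉ openCluster ω a₁} =
      (openConn o a₁ ∩ (openConn o a₂)ᶜ) ∪ (openConn o a₂ ∩ (openConn o a₁)ᶜ) := by
  have hsd : ({a₁, a₂} : Finset V) \ {a₁} = {a₂} := by
    ext y
    simp only [Finset.mem_sdiff, Finset.mem_insert, Finset.mem_singleton]
    constructor
    · rintro ⟨h | h, hne⟩
      · exact absurd h hne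
      · exact h
    · rintro rfl; exact ⟨Or.inr rfl, fun h => h12 h.symm⟩
  rw [hsd]
  ext ω
  simp only [connTo, mem_inter_iff, mem_iUnion, Finset.mem_insert, Finset.mem_singleton, exists_prop,
    mem_setOf_eq, mem_union, mem_compl_iff, forall_eq]
  constructor
  · rintro ⟨⟨a, ha, hω⟩, hn⟩
    rcases ha with rfl | rfl
    · exact Or.inl ⟨hω, fun h2 => hn ((SimpleGraph.Reachable.symm hω).trans h2)⟩
    · exact Or.inr ⟨hω, fun h1 => hn ((SimpleGraph.Reachable.symm h1).trans hω)⟩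
  · rintro (⟨h1, h2⟩ | ⟨h2, h1⟩)
    · exact ⟨⟨a₁, Or.inl rfl, h1⟩, fun hyC => h2 (h1.trans hyC)⟩
    · exact ⟨⟨a₂, Or.inr rfl, h2⟩, fun hyC => h1 (h2.trans (SimpleGraph.Reachable.symm hyC))⟩

/-- **`|A| = 2` rigidity.**  For two targets `a₁ ≠ a₂`, any vector `c` dominating every up-set (as in
`KNUniformUpsets`) satisfies `c_{a₁} (x₁ + x₂) = x₁` and `c_{a₂} (x₁ + x₂) = x₂`, where
`x₁ = μ(o ↔ a₁, o ↮ a₂)`, `x₂ = μ(o ↔ a₂, o ↮ a₁)` are the single-contact probabilities: the uniform vector is the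
normalised single-contact law.  (New; with [KozmaNitzan2024, Thm 7] it identifies the `b`-independent coefficients
of their §5.2 for `|A| = 2`.) -/
theorem pair_rigidity (w : Sym2 V → unitInterval) (o a₁ a₂ : V) (h12 : a₁ ≠ a₂) (c : V → ℝ)
    (hc1 : ∑ a ∈ ({a₁, a₂} : Finset V), c a = 1)
    (hc : ∀ 𝒰 : Set (Set V), IsUpperSet 𝒰 →
      ∑ a ∈ ({a₁, a₂} : Finset V), c a * clusterExp w {a₁, a₂} o (setInd 𝒰) a ≤
        clusterExp w {a₁, a₂} o (setInd 𝒰) o) :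
    c a₁ * ((prodBernoulli w).real (openConn o a₁ ∩ (openConn o a₂)ᶜ) +
        (prodBernoulli w).real (openConn o a₂ ∩ (openConn o a₁)ᶜ)) =
      (prodBernoulli w).real (openConn o a₁ ∩ (openConn o a₂)ᶜ) ∧
    c a₂ * ((prodBernoulli w).real (openConn o a₁ ∩ (openConn o a₂)ᶜ) +
        (prodBernoulli w).real (openConn o a₂ ∩ (openConn o a₁)ᶜ)) =
      (prodBernoulli w).real (openConn o a₂ ∩ (openConn o a₁)ᶜ) := by
  classical
  have hdisj : Disjoint (openConn o a₁ ∩ (openConn o a₂)ᶜ : Set (BondConfig V))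
      (openConn o a₂ ∩ (openConn o a₁)ᶜ) := by
    rw [Set.disjoint_left]
    rintro ω ⟨h1, -⟩ ⟨-, h1'⟩
    exact h1' h1
  have hU : (prodBernoulli w).real ((openConn o a₁ ∩ (openConn o a₂)ᶜ) ∪ (openConn o a₂ ∩ (openConn o a₁)ᶜ)) =
      (prodBernoulli w).real (openConn o a₁ ∩ (openConn o a₂)ᶜ) +
        (prodBernoulli w).real (openConn o a₂ ∩ (openConn o a₁)ᶜ) :=
    measureReal_union hdisj MeasurableSet.of_discrete
  -- covering constraint for `D = {a₁}` and, by symmetry, for `D = {a₂}`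
  have k1 := covering_of_uniform w {a₁, a₂} o c hc1 hc {a₁} (by simp)
  rw [Finset.sum_singleton, connTo_pair_misses_eq o a₁ a₂ h12, connTo_pair_notConn_eq o a₁ a₂ h12, hU] at k1
  have hpair : ({a₁, a₂} : Finset V) = {a₂, a₁} := Finset.pair_comm a₁ a₂
  have hc1' : ∑ a ∈ ({a₂, a₁} : Finset V), c a = 1 := by rw [← hpair]; exact hc1
  have hc' : ∀ 𝒰 : Set (Set V), IsUpperSet 𝒰 →
      ∑ a ∈ ({a₂, a₁} : Finset V), c a * clusterExp w {a₂, a₁} o (setInd 𝒰) a ≤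
        clusterExp w {a₂, a₁} o (setInd 𝒰) o := by
    rw [← hpair]; exact hc
  have k2 := covering_of_uniform w {a₂, a₁} o c hc1' hc' {a₂} (by simp)
  rw [Finset.sum_singleton, connTo_pair_misses_eq o a₂ a₁ h12.symm, connTo_pair_notConn_eq o a₂ a₁ h12.symm,
    union_comm, hU] at k2
  rw [Finset.sum_pair h12] at hc1
  have hx1 : 0 ≤ (prodBernoulli w).real (openConn o a₁ ∩ (openConn o a₂)ᶜ) := measureReal_nonneg
  have hx2 : 0 ≤ (prodBernoulli w).real (openConn o a₂ ∩ (openConn o a₁)ᶜ) := measureReal_nonneg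
  have hsum : c a₁ * ((prodBernoulli w).real (openConn o a₁ ∩ (openConn o a₂)ᶜ) +
        (prodBernoulli w).real (openConn o a₂ ∩ (openConn o a₁)ᶜ)) +
      c a₂ * ((prodBernoulli w).real (openConn o a₁ ∩ (openConn o a₂)ᶜ) +
        (prodBernoulli w).real (openConn o a₂ ∩ (openConn o a₁)ᶜ)) =
      (prodBernoulli w).real (openConn o a₁ ∩ (openConn o a₂)ᶜ) +
        (prodBernoulli w).real (openConn o a₂ ∩ (openConn o a₁)ᶜ) := by
    rw [← add_mul, hc1, one_mul]
  constructor <;> linarith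

end Percolation

end Summit.CriticalPhenomena.PercolationContinuityZ3.Theorems.SoloBlindKN

end
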